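import Summits.ABC.StewartYu.RecordNumericC
import HarnessLib

/-!
# Cell abc-stewartyu, Gen-3 record (WP-M3.R): `RecordTwo` / `RecordOdd` for `PadicG3Par` with the explicit
# admissible constant `C m = 256^m`

`Summits/ABC/StewartYu/RecordByName.lean` — cell `abc-stewartyu` (HOME `run/shared/lean/pub/abc-stewartyu/`),
route `PadicPrimesKummerThird`, cruxes `Y07Odd` (stmt-ABC-19658) / `Y07Two` (stmt-ABC-19659); seat lp-1 (g2).
Theorems only.

The frames' `stub_frameOdd` / `stub_frameTwo` ask for `∃ C c₁, (∀ m, C m ≤ c₁^m) ∧ …`; the record's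
`recordTwo_of_convention` / `recordOdd_of_convention` (`RecordNumericC`) hold for every `C` with `0 ≤ C r`
and `256^{n−r}·C r ≤ C n`.  Here: the canonical choice `C m := 256^m` (so `c₁ = 256`, `C 1 = 256 ≥ 4`),
leaving only the instantiation-convention hypotheses `K ≤ N_q ≤ 2ⁿK`, `½ ≤ θ₀`, `Amax ≤ 2ⁿΩ`, `1 ≤ Aⱼ`.

References: Yu. V. Nesterenko, LNM 1819 (2003), §5.2, Prop. 5.1.
-/

noncomputable section

open Finset Real Nat

namespace Summit.ABC.StewartYu

namespace PadicG3Par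

open Summit.ABC.StewartYu.GenThreeFrameSpecTwo (RecordTwo)
open Summit.ABC.StewartYu.GenThreeFrameSpecOdd (RecordOdd)

variable {n : ℕ} (P : PadicG3Par n)

/-- `C m = 256^m` is admissible: `0 ≤ C r` and `256^{n−r}·C r = C n` for `r ≤ n`. [folklore] -/
theorem pow256_admissible (n : ℕ) :
    (∀ r : ℕ, (0 : ℝ) ≤ (256 : ℝ) ^ r) ∧
    (∀ r : ℕ, r < n → (256 : ℝ) ^ (n - r) * (256 : ℝ) ^ r ≤ (256 : ℝ) ^ n) := by
  refine ⟨fun r => by positivity, fun r hr => ?_⟩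
  rw [← pow_add, Nat.sub_add_cancel hr.le]

/-- **`RecordTwo (fun m => 256^m) n P.A P.Amax P.W P.D₀ P.S₀N P.Xfin P.D`** under the instantiation
convention alone. [cite: Nesterenko2003, §5.2 (5.13)–(5.22)] -/
theorem recordTwo (hKNq : P.K ≤ P.Nq) (hNqK : P.Nq ≤ 2 ^ n * P.K) (hθ : (1 / 2 : ℝ) ≤ P.θ₀)
    (hAmax : P.Amax ≤ 2 ^ n * P.Ω) (hA1 : ∀ j, 1 ≤ P.A j) :
    RecordTwo (fun m => (256 : ℝ) ^ m) n P.A P.Amax P.W P.D₀ P.S₀N P.Xfin P.D :=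
  P.recordTwo_of_convention hKNq hNqK hθ hAmax hA1 (pow256_admissible n).1 (pow256_admissible n).2

/-- **`RecordOdd (fun m => 256^m) p n P.A P.Amax P.W P.D₀ P.S₀N P.Xfin P.D`** (any `p`) under the
instantiation convention alone. [cite: Nesterenko2003, §5.2 (5.13)–(5.22)] -/
theorem recordOdd (hKNq : P.K ≤ P.Nq) (hNqK : P.Nq ≤ 2 ^ n * P.K) (hθ : (1 / 2 : ℝ) ≤ P.θ₀)
    (hAmax : P.Amax ≤ 2 ^ n * P.Ω) (hA1 : ∀ j, 1 ≤ P.A j) (p : ℕ) :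
    RecordOdd (fun m => (256 : ℝ) ^ m) p n P.A P.Amax P.W P.D₀ P.S₀N P.Xfin P.D :=
  P.recordOdd_of_convention hKNq hNqK hθ hAmax hA1 p (pow256_admissible n).1 (pow256_admissible n).2

end PadicG3Par

end Summit.ABC.StewartYu

end
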